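import Literature.Probability.Percolation.CornerPercolation
import Literature.Probability.Percolation.IsoradialProofs
import HarnessLib

/-!
# Stub `stub_render` (crux stmt-CriticalPhenomena-5476 `UniformBoxCrossing`, line `Sketch`):
# uniform lattice bounds ⇒ `BoxCrossingBounds (cornerPercolation t) squareLatticeEmbedding.z`

The rendering step of the box-crossing engine for the corner percolation models
`M_t = cornerPercolation t` on `ℤ²`, `t ∈ [0, 1]`, drawn isoradially as `√2 ℤ²`
(`squareLatticeEmbedding.z v = √2 (v₀ + i v₁)`): uniform (in `t`) two-sided bounds for the
left–right crossing probabilities of lattice rectangles of bounded aspect ratio give the embedded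
two-sided bounds `BoxCrossingBounds (cornerPercolation t) squareLatticeEmbedding.z ρ c n₀` with
`c, n₀` independent of `t`. This is the `√2 ℤ²` sandwich of
`Literature.Probability.Percolation.square_embRectCrossing_bounds` (there for `P_{1/2}`,
Grimmett–Manolescu 2014, §2.3), with the `P_{1/2}`-specific inputs replaced by their `M_t`
versions:

* `cornerPercolation_real_lrCrossing_le_real_embRectCrossing` — the embedded horizontal crossing
  event contains a translated lattice left–right crossing (`shift_lrCrossing_subset_embRectCrossing`,
  translation invariance `cornerPercolation_real_openCrossing_shift`);
* `cornerPercolation_real_embRectCrossing_le_real_lrCrossing` — and is `M_t`-a.s. contained in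
  another one (`mem_shift_lrCrossing_of_mem_embRectCrossing` on lattice configurations,
  `cornerPercolation_subset_edgeSet`);
* `cornerPercolation_real_openCrossing_transpose`,
  `cornerPercolation_real_embTBCrossing_eq_real_embRectCrossing` — vertical crossings are
  horizontal crossings of the transposed picture (`cornerPercolation_real_preimage_relabel_transpose`);
* `cornerPercolation_embRectCrossing_bounds` — the floor/ceil bookkeeping of
  `square_embRectCrossing_bounds`, with `n₀` enlarged so that the two lattice rectangles are large
  enough for the hypotheses `hLB`, `hUB`;
* `stub_render` — the registered stub.
-/

noncomputable section

namespace Summit.CriticalPhenomena.CardyFormulaZ2.Cruxes.UniformBoxCrossing.NonSlantLine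

open MeasureTheory Literature.Probability.Percolation Literature.Probability.LatticeModels

/-- **A lattice crossing inside the embedded one, for `M_t`.** Under the hypotheses of
`shift_lrCrossing_subset_embRectCrossing` (the translated lattice rectangle
`(i, j) + [0, M] × [0, N]`, drawn by `v ↦ √2 v - w`, sits in the strip `[-2, a + 2] × [0, b]` with
its left column in `{re ≤ 0}` and its right column in `{a ≤ re}`),
`M_t(LR([0, M] × [0, N])) ≤ M_t(C_h)` for the embedded horizontal crossing event `C_h` of
`[0, a] × [0, b]` (translation invariance of `M_t`, `cornerPercolation_real_openCrossing_shift`).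
[folklore] -/
theorem cornerPercolation_real_lrCrossing_le_real_embRectCrossing (t : unitInterval) (w : ℂ)
    (a b : ℝ) (i j : ℤ) (M N : ℕ)
    (h1 : Real.sqrt 2 * i ≤ w.re) (h2 : w.re - 2 ≤ Real.sqrt 2 * i)
    (h3 : w.re + a ≤ Real.sqrt 2 * (i + M)) (h4 : Real.sqrt 2 * (i + M) ≤ w.re + a + 2)
    (h5 : w.im ≤ Real.sqrt 2 * j) (h6 : Real.sqrt 2 * (j + N) ≤ w.im + b) :
    (cornerPercolation t).real (lrCrossing M N) ≤ (cornerPercolation t).real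
      (embRectCrossing (fun v => squareLatticeEmbedding.z v - w) a b) := by
  rw [lrCrossing, ← cornerPercolation_real_openCrossing_shift t ![i, j]]
  exact measureReal_mono
    (shift_lrCrossing_subset_embRectCrossing w a b i j M N h1 h2 h3 h4 h5 h6)

/-- **The embedded crossing inside a lattice one, for `M_t`.** Under the hypotheses of
`mem_shift_lrCrossing_of_mem_embRectCrossing` (columns drawn in `{re ≤ 0}` have index `≤ iL`,
columns drawn in `{a ≤ re}` have index `≥ iR ≥ iL`, rows drawn in `{0 ≤ im ≤ b}` have index in
`[jB, jT]`), `M_t(C_h) ≤ M_t(LR([0, iR - iL] × [0, jT - jB]))`: `M_t` is carried by lattice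
configurations (`cornerPercolation_subset_edgeSet`) and translation invariant
(`cornerPercolation_real_openCrossing_shift`). [folklore] -/
theorem cornerPercolation_real_embRectCrossing_le_real_lrCrossing (t : unitInterval) (w : ℂ)
    (a b : ℝ) (iL iR jB jT : ℤ)
    (hiL : ∀ s : ℤ, Real.sqrt 2 * s ≤ w.re → s ≤ iL)
    (hiR : ∀ s : ℤ, w.re + a ≤ Real.sqrt 2 * s → iR ≤ s) (hLR : iL ≤ iR)
    (hjB : ∀ s : ℤ, w.im ≤ Real.sqrt 2 * s → jB ≤ s)
    (hjT : ∀ s : ℤ, Real.sqrt 2 * s ≤ w.im + b → s ≤ jT) :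
    (cornerPercolation t).real
        (embRectCrossing (fun v => squareLatticeEmbedding.z v - w) a b) ≤
      (cornerPercolation t).real (lrCrossing (iR - iL).toNat (jT - jB).toNat) := by
  rw [lrCrossing, ← cornerPercolation_real_openCrossing_shift t ![iL, jB]]
  refine ENNReal.toReal_mono (measure_ne_top _ _) (measure_mono_ae ?_)
  filter_upwards [cornerPercolation_subset_edgeSet t] with ω hω hc
  exact mem_shift_lrCrossing_of_mem_embRectCrossing hω w a b iL iR jB jT hiL hiR hLR hjB hjT hc

/-- Transposed open crossing events have the same `M_t`-probability (`M_t` is invariant under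
the transposition of the axes, `cornerPercolation_real_preimage_relabel_transpose`, and
`preimage_relabel_openCrossing`). [folklore] -/
theorem cornerPercolation_real_openCrossing_transpose (t : unitInterval) (S A B : Set (Site 2)) :
    (cornerPercolation t).real (openCrossing ((transposeIso : Site 2 → Site 2) '' S)
        ((transposeIso : Site 2 → Site 2) '' A) ((transposeIso : Site 2 → Site 2) '' B)) =
      (cornerPercolation t).real (openCrossing S A B) := by
  rw [← preimage_relabel_openCrossing transposeIso.toEquiv S A B,
    cornerPercolation_real_preimage_relabel_transpose]
  rfl

/-- **Vertical crossings are horizontal crossings of the transposed picture, for `M_t`.**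
Transposing `ℤ²` (`transposeIso`, which preserves `M_t`) carries the vertical crossing event of
`[0, a] × [0, b]` for the drawing `v ↦ √2 v - w` to the horizontal crossing event of
`[0, b] × [0, a]` for the drawing `v ↦ √2 v - w̃`, `w̃ = (im w, re w)`; hence the two have the same
`M_t`-probability (as `real_embTBCrossing_eq_real_embRectCrossing` for `P_{1/2}`). [folklore] -/
theorem cornerPercolation_real_embTBCrossing_eq_real_embRectCrossing (t : unitInterval) (w : ℂ)
    (a b : ℝ) :
    (cornerPercolation t).real
        (embTBCrossing (fun v => squareLatticeEmbedding.z v - w) a b) =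
      (cornerPercolation t).real
        (embRectCrossing (fun v => squareLatticeEmbedding.z v - ⟨w.im, w.re⟩) b a) := by
  rw [embRectCrossing, ← cornerPercolation_real_openCrossing_transpose t, embTBCrossing,
    image_transposeIso, image_transposeIso, image_transposeIso]
  congr 2
  · ext v
    simp only [Set.mem_setOf_eq, Set.mem_preimage, squareLatticeEmbedding_z_sub_re,
      squareLatticeEmbedding_z_sub_im, transposeIso_apply_zero, transposeIso_apply_one]
    exact and_comm
  · ext v
    simp only [Set.mem_setOf_eq, Set.mem_preimage, squareLatticeEmbedding_z_sub_re,
      squareLatticeEmbedding_z_sub_im, transposeIso_apply_zero]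
  · ext v
    simp only [Set.mem_setOf_eq, Set.mem_preimage, squareLatticeEmbedding_z_sub_re,
      squareLatticeEmbedding_z_sub_im, transposeIso_apply_zero]

/-- **Box-crossing bounds for the horizontal crossings of `√2 ℤ²` under `M_t`, uniformly in
`t`.** If for every `k` there are `c > 0`, `n₀` (independent of `t`) with
`c ≤ M_t(LR([0, M] × [0, N]))` whenever `N ≥ n₀`, `M ≤ k N`, and with
`M_t(LR([0, M] × [0, N])) ≤ 1 - c` whenever `M ≥ n₀`, `N ≤ k M`, then for every aspect ratio
`ρ > 0` there are `c > 0` and `n₀` such that for all `t`, all `n ≥ n₀` and all translations `w`,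
the Euclidean rectangle `w + [0, ρ n] × [0, n]` is crossed horizontally by `√2 ℤ²` with
`M_t`-probability in `[c, 1 - c]`. Sandwich: the embedded crossing event contains the left–right
crossing of a lattice rectangle of `≈ (ρ n/√2 + 2) × (n/√2 - 2)` sites (aspect ratio
`≤ ⌈ρ⌉₊ + 1` once `n ≥ 4 (⌈ρ⌉₊ + 1) + 6`) and is `M_t`-a.s. contained in that of a lattice
rectangle of `≈ (ρ n/√2) × (n/√2)` sites (inverse aspect ratio `≤ ⌈ρ⁻¹⌉₊ + 1`); `n₀` is taken so
large that the heights/widths of these rectangles exceed the thresholds of the hypotheses.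
(Grimmett–Manolescu 2014, §2.3, for `P_{1/2}`: `square_embRectCrossing_bounds`.)
[cite: GrimmettManolescu2014, §2.3] -/
theorem cornerPercolation_embRectCrossing_bounds
    (hLB : ∀ k : ℕ, ∃ c : ℝ, 0 < c ∧ ∃ n₀ : ℕ, ∀ (t : unitInterval) (M N : ℕ), n₀ ≤ N →
      M ≤ k * N → c ≤ (cornerPercolation t).real (lrCrossing M N))
    (hUB : ∀ k : ℕ, ∃ c : ℝ, 0 < c ∧ ∃ n₀ : ℕ, ∀ (t : unitInterval) (M N : ℕ), n₀ ≤ M →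
      N ≤ k * M → (cornerPercolation t).real (lrCrossing M N) ≤ 1 - c)
    {ρ : ℝ} (hρ : 0 < ρ) :
    ∃ c > 0, ∃ n₀ : ℕ, ∀ (t : unitInterval) (n : ℕ), n₀ ≤ n → ∀ w : ℂ,
      c ≤ (cornerPercolation t).real
          (embRectCrossing (fun v => squareLatticeEmbedding.z v - w) (ρ * n) n) ∧
        (cornerPercolation t).real
          (embRectCrossing (fun v => squareLatticeEmbedding.z v - w) (ρ * n) n) ≤ 1 - c := by
  obtain ⟨c₁, hc₁, n₁, h₁⟩ := hLB (⌈ρ⌉₊ + 1)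
  obtain ⟨c₂, hc₂, n₂, h₂⟩ := hUB (⌈ρ⁻¹⌉₊ + 1)
  refine ⟨min c₁ c₂, lt_min hc₁ hc₂, 4 * (⌈ρ⌉₊ + 1) + 6 + 2 * n₁ + 2 * (⌈ρ⁻¹⌉₊ + 1) * n₂,
    fun t n hn w => ?_⟩
  obtain ⟨hs1, hs2⟩ := one_lt_sqrt_two_and_lt_two
  have hs0 : 0 < Real.sqrt 2 := by linarith
  -- the aspect-ratio constants
  set k₁ : ℕ := ⌈ρ⌉₊ + 1 with hk₁
  set k₂ : ℕ := ⌈ρ⁻¹⌉₊ + 1 with hk₂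
  have hk₁ρ : ρ + 1 ≤ k₁ := by
    have := Nat.le_ceil ρ
    simp only [hk₁, Nat.cast_add, Nat.cast_one]; linarith
  have hk₂ρ : ρ⁻¹ ≤ k₂ := by
    have := Nat.le_ceil ρ⁻¹
    simp only [hk₂, Nat.cast_add, Nat.cast_one]; linarith
  have hnr : ((4 * k₁ + 6 + 2 * n₁ + 2 * k₂ * n₂ : ℕ) : ℝ) ≤ n := by exact_mod_cast hn
  push_cast at hnr
  have hn₁0 : (0 : ℝ) ≤ n₁ := Nat.cast_nonneg _
  have hn₂0 : (0 : ℝ) ≤ n₂ := Nat.cast_nonneg _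
  have hk₂0 : (0 : ℝ) ≤ k₂ := Nat.cast_nonneg _
  have hk₂n₂ : (0 : ℝ) ≤ k₂ * n₂ := mul_nonneg hk₂0 hn₂0
  have hn' : (4 * k₁ + 6 : ℝ) ≤ n := by linarith
  have hk₁1 : (1 : ℝ) ≤ k₁ := by exact_mod_cast (show 1 ≤ k₁ by omega)
  have hρn : 0 < ρ * n := mul_pos hρ (by linarith)
  -- the lattice rectangle read off from `w`
  set iL : ℤ := ⌊w.re / Real.sqrt 2⌋ with hiLdef
  set iR : ℤ := ⌈(w.re + ρ * n) / Real.sqrt 2⌉ with hiRdef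
  set jB : ℤ := ⌈w.im / Real.sqrt 2⌉ with hjBdef
  set jT : ℤ := ⌊(w.im + n) / Real.sqrt 2⌋ with hjTdef
  have eL1 : Real.sqrt 2 * iL ≤ w.re := by
    have := Int.floor_le (w.re / Real.sqrt 2)
    rw [le_div_iff₀ hs0] at this; linarith
  have eL2 : w.re < Real.sqrt 2 * iL + Real.sqrt 2 := by
    have := Int.lt_floor_add_one (w.re / Real.sqrt 2)
    rw [div_lt_iff₀ hs0] at this; linarith
  have eR1 : w.re + ρ * n ≤ Real.sqrt 2 * iR := by
    have := Int.le_ceil ((w.re + ρ * n) / Real.sqrt 2)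
    rw [div_le_iff₀ hs0] at this; linarith
  have eR2 : Real.sqrt 2 * iR < w.re + ρ * n + Real.sqrt 2 := by
    have h := Int.ceil_lt_add_one ((w.re + ρ * n) / Real.sqrt 2)
    have h' : (iR : ℝ) - 1 < (w.re + ρ * n) / Real.sqrt 2 := by linarith
    rw [lt_div_iff₀ hs0] at h'; linarith
  have eB1 : w.im ≤ Real.sqrt 2 * jB := by
    have := Int.le_ceil (w.im / Real.sqrt 2)
    rw [div_le_iff₀ hs0] at this; linarith
  have eB2 : Real.sqrt 2 * jB < w.im + Real.sqrt 2 := by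
    have h := Int.ceil_lt_add_one (w.im / Real.sqrt 2)
    have h' : (jB : ℝ) - 1 < w.im / Real.sqrt 2 := by linarith
    rw [lt_div_iff₀ hs0] at h'; linarith
  have eT1 : Real.sqrt 2 * jT ≤ w.im + n := by
    have := Int.floor_le ((w.im + n) / Real.sqrt 2)
    rw [le_div_iff₀ hs0] at this; linarith
  have eT2 : w.im + n < Real.sqrt 2 * jT + Real.sqrt 2 := by
    have := Int.lt_floor_add_one ((w.im + n) / Real.sqrt 2)
    rw [div_lt_iff₀ hs0] at this; linarith
  -- integer consequences
  have hLR' : (iL : ℝ) < iR := lt_of_mul_lt_mul_left (by linarith) hs0.le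
  have hLR : iL < iR := by exact_mod_cast hLR'
  have hBT' : (jB : ℝ) + 1 < jT := lt_of_mul_lt_mul_left (by linarith) hs0.le
  have hBT : jB + 1 < jT := by exact_mod_cast hBT'
  set M : ℕ := (iR - iL).toNat with hMdef
  set N : ℕ := (jT - jB).toNat with hNdef
  have hM : (M : ℤ) = iR - iL := Int.toNat_of_nonneg (by omega)
  have hN : (N : ℤ) = jT - jB := Int.toNat_of_nonneg (by omega)
  have hMr : (M : ℝ) = iR - iL := by exact_mod_cast hM
  have hNr : (N : ℝ) = jT - jB := by exact_mod_cast hN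
  -- the sizes of the lattice rectangles (all estimates are linear in the monomials)
  have hMρ : ρ * n ≤ Real.sqrt 2 * M := by rw [hMr]; linarith
  have hM2 : Real.sqrt 2 * M < ρ * n + 2 * Real.sqrt 2 := by rw [hMr]; linarith
  have hNn : (n : ℝ) - 2 * Real.sqrt 2 < Real.sqrt 2 * N := by rw [hNr]; linarith
  have hN2 : Real.sqrt 2 * N ≤ n := by rw [hNr]; linarith
  have hk : 1 ≤ (k₂ : ℝ) * ρ := by
    have := mul_le_mul_of_nonneg_right hk₂ρ hρ.le
    rwa [inv_mul_cancel₀ hρ.ne'] at this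
  -- `n₁ ≤ N` and `n₂ ≤ M`
  have hN₁ : n₁ ≤ N := by
    have hc : Real.sqrt 2 * n₁ ≤ 2 * n₁ := mul_le_mul_of_nonneg_right hs2.le hn₁0
    have h : (n₁ : ℝ) < N := lt_of_mul_lt_mul_left (by linarith) hs0.le
    exact_mod_cast h.le
  have hM₂ : n₂ ≤ M := by
    have hA : ρ * (2 * k₂ * n₂) ≤ ρ * n := mul_le_mul_of_nonneg_left (by linarith) hρ.le
    have hB : (n₂ : ℝ) ≤ k₂ * ρ * n₂ := le_mul_of_one_le_left hn₂0 hk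
    have hC : Real.sqrt 2 * n₂ ≤ 2 * n₂ := mul_le_mul_of_nonneg_right hs2.le hn₂0
    have h : (n₂ : ℝ) ≤ M := le_of_mul_le_mul_left (by linarith) hs0
    exact_mod_cast h
  -- `M ≤ k₁ N` and `N ≤ k₂ M`
  have hMN : M ≤ k₁ * N := by
    have hp1 : (k₁ : ℝ) * (n - 2 * Real.sqrt 2) ≤ k₁ * (Real.sqrt 2 * N) :=
      mul_le_mul_of_nonneg_left hNn.le (by linarith)
    have hp2 : (0 : ℝ) ≤ (k₁ - ρ - 1) * n := mul_nonneg (by linarith) (Nat.cast_nonneg n)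
    have hp3 : Real.sqrt 2 * k₁ ≤ 2 * k₁ := mul_le_mul_of_nonneg_right hs2.le (by linarith)
    have h3 : (M : ℝ) < k₁ * N := lt_of_mul_lt_mul_left (by linarith) hs0.le
    exact_mod_cast h3.le
  have hNM : N ≤ k₂ * M := by
    have hq1 : (k₂ : ℝ) * (ρ * n) ≤ k₂ * (Real.sqrt 2 * M) := mul_le_mul_of_nonneg_left hMρ hk₂0
    have hq2 : (0 : ℝ) ≤ (k₂ * ρ - 1) * n := mul_nonneg (by linarith) (Nat.cast_nonneg n)
    have h3 : (N : ℝ) ≤ k₂ * M := le_of_mul_le_mul_left (by linarith) hs0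
    exact_mod_cast h3
  constructor
  · calc min c₁ c₂ ≤ c₁ := min_le_left _ _
      _ ≤ (cornerPercolation t).real (lrCrossing M N) := h₁ t M N hN₁ hMN
      _ ≤ _ := by
        refine cornerPercolation_real_lrCrossing_le_real_embRectCrossing t w (ρ * n) n iL jB M N
          eL1 (by linarith) ?_ ?_ eB1 ?_
        · rw [hMr]; linarith
        · rw [hMr]; linarith
        · rw [hNr]; linarith
  · calc _ ≤ (cornerPercolation t).real (lrCrossing M N) := by
          refine cornerPercolation_real_embRectCrossing_le_real_lrCrossing t w (ρ * n) n
            iL iR jB jT ?_ ?_ hLR.le ?_ ?_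
          · intro s hs
            rw [hiLdef, Int.le_floor, le_div_iff₀ hs0]; linarith
          · intro s hs
            rw [hiRdef, Int.ceil_le, div_le_iff₀ hs0]; linarith
          · intro s hs
            rw [hjBdef, Int.ceil_le, div_le_iff₀ hs0]; linarith
          · intro s hs
            rw [hjTdef, Int.le_floor, le_div_iff₀ hs0]; linarith
      _ ≤ 1 - c₂ := h₂ t M N hM₂ hNM
      _ ≤ 1 - min c₁ c₂ := by linarith [min_le_right c₁ c₂]

/-- **Stub 6 (rendering on `√2 ℤ²`).** Uniform two-sided bounds for lattice rectangles of bounded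
aspect ratio give `BoxCrossingBounds (cornerPercolation t) squareLatticeEmbedding.z ρ c n₀` with
`c, n₀` independent of `t`: the embedded horizontal crossing event of `w + [0, ρ n] × [0, n]`
contains the left–right crossing of a lattice rectangle of `≈ (ρ n/√2 + 2) × (n/√2 - 2)` sites
and is a.s. contained in that of one of `≈ (ρ n/√2) × (n/√2)` sites
(`shift_lrCrossing_subset_embRectCrossing`, `mem_shift_lrCrossing_of_mem_embRectCrossing`,
translation invariance `cornerPercolation_real_openCrossing_shift`, `cornerPercolation_subset_edgeSet`);
vertical crossings by the transposition symmetry `cornerPercolation_real_preimage_relabel_transpose`.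
(Grimmett–Manolescu 2014, §2.3, for `P_{1/2}`: `square_embRectCrossing_bounds`.)
[cite: GrimmettManolescu2014, §2.3] -/
theorem stub_render
    (hLB : ∀ k : ℕ, ∃ c : ℝ, 0 < c ∧ ∃ n₀ : ℕ, ∀ (t : unitInterval) (M N : ℕ), n₀ ≤ N →
      M ≤ k * N → c ≤ (cornerPercolation t).real (lrCrossing M N))
    (hUB : ∀ k : ℕ, ∃ c : ℝ, 0 < c ∧ ∃ n₀ : ℕ, ∀ (t : unitInterval) (M N : ℕ), n₀ ≤ M →
      N ≤ k * M → (cornerPercolation t).real (lrCrossing M N) ≤ 1 - c) :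
    ∀ ρ : ℝ, 0 < ρ → ∃ c > 0, ∃ n₀ : ℕ, ∀ t : unitInterval,
      BoxCrossingBounds (cornerPercolation t) squareLatticeEmbedding.z ρ c n₀ := by
  intro ρ hρ
  obtain ⟨c, hc, n₀, h⟩ := cornerPercolation_embRectCrossing_bounds hLB hUB hρ
  refine ⟨c, hc, n₀, fun t n hn w => ⟨h t n hn w, ?_⟩⟩
  rw [cornerPercolation_real_embTBCrossing_eq_real_embRectCrossing]
  exact h t n hn _

end Summit.CriticalPhenomena.CardyFormulaZ2.Cruxes.UniformBoxCrossing.NonSlantLine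

end
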